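import Summits.NavierStokesRegularity.NavierStokesRegularity.Theorems.ScenarioCensusRowF1SnapshotTopRows
import Summits.NavierStokesRegularity.NavierStokesRegularity.Theorems.ScenarioCensusRowF1CagedTop
import HarnessLib

/-!
# LINE «snapshot-top» port, part 4/4: §6 second instance on the gradient axis — RIGID pockets (`Row_F1rs`, `rowF1rs_holds`, `rigidLevel`, `RigidFloor`); §7 order remarks, summary;
# census KEYS `Row_F1cs` / `Row_F1ce` / `Row_F1rs` + `_excluded`, floors SF / RF, edges

Re-homed for the scenario census (typer seat ns-census-typer-1 g9; the cells F1cs / F1ce / F1rs and the floors are members of row F1 «DECIDED IN KERNEL IN FILES» (item 75; ref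
ns-census-ref g13 PRE-CHECK ✓ §18.16; critic PASS; lead label); this port makes them TREE-decided): VERBATIM PORT of ns-idea-3 LINE «snapshot-top»,
`pub/ideators/ns-idea-3/lines/snapshot-top/line-snapshot-top.lean` sha16 5c984c2d30725568 (996 l., lean check rc 0, 0 sorry), split for the 400-line rule into
`ScenarioCensusRowF1SnapshotTop` (§1–§2) → `…SnapshotTopZoom` (§3–§4) → `…SnapshotTopRows` (§5) → `…SnapshotTopRigid` (§6–§7 + census KEYS).  Lean text VERBATIM in namespace
`…Theorems.ScenarioCensus.SnapshotTop` (the line's `…Cruxes.ScenarioCensusRowF1.SnapshotTopLine` re-homed); port edits: LINE 34's `topSet` (+ lemmas) and LINE 35's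
`HasTypeIConstant` (+ lemmas), restated VERBATIM by the line, are taken BY NAME from the landed two-time-top / one-level-top ports; the second proof term `rowF1po_holds` is
not re-declared; `@[conjecture]` on the residual `SnapshotCollapse` (≡ `ScenarioCensus.Row_F1`, OPEN); ten one-line docstrings added (gate lint).  Statements untouched.

No census VALUE is moved here (row F1 stays OPEN-WITH-LINE; the members become TREE-decided by name); NS regularity is NOT proved; `Row_F1` is untouched (zero
movement, `snapshotCollapse_iff_rowF1`); no summit statement is proved by this file.
-/

-- the summit and its single problem share the name `NavierStokesRegularity` (D-0017 nested layout)
set_option linter.dupNamespace false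

noncomputable section

open MeasureTheory Set Function Filter TopologicalSpace Metric
open scoped Topology NNReal ENNReal

namespace Summit.NavierStokesRegularity.NavierStokesRegularity.Theorems.ScenarioCensus.SnapshotTop

open Literature.Analysis Literature.Analysis.FluidPDE
open Summit.NavierStokesRegularity.NavierStokesRegularity.Theorems
open Summit.NavierStokesRegularity.NavierStokesRegularity.Theses

/-! ## §6 Second instance on the GRADIENT axis: RIGID pockets (plug flow at the critical scale) — kill (K2) = (KC)

A pocket is **rigid** when the DIMENSIONLESS GRADIENT `(T − t)|∇u(t, x')|` is `≤ ε` on it (the fluid there may move at full Type-I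
speed, but as a plug).  In the zoom `∇_y W_j(−1, y) = c_j · c_jν · ∇u = (T − t_j) ∇u`, so rigid pockets pass to the limit slice as
balls on which `|∇W(−1, ·)| ≤ ε_n → 0`: the limit slice has zero gradient on a ball, is constant there (mean value inequality),
constant everywhere (analyticity), and ONE constant slice kills (`eq_zero_of_sliceConst`).  Calm and rigid pockets are
non-equivalent snapshot conditions (a calm pocket may oscillate at small amplitude; a rigid pocket may be fast). -/

/-- **A slice constant on a ball is constant** (analyticity). -/
theorem slice_const_of_ball {M : ℝ} {W : ℝ → E3 → E3} (hW : IsTypeIAncientMild M W) {t : ℝ} (ht : t < 0)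
    {z : E3} {r : ℝ} (hr : 0 < r) {a₀ : E3} (h : ∀ y ∈ ball z r, W t y = a₀) : ∀ y : E3, W t y = a₀ := by
  have han : AnalyticOnNhd ℝ (fun y => W t y - a₀) univ := fun y _ =>
    (hW.analyticOnNhd_slice_univ ht y (mem_univ y)).sub analyticAt_const
  have hz : ∀ᶠ y in 𝓝 z, W t y - a₀ = 0 := by
    filter_upwards [ball_mem_nhds z hr] with y hy
    rw [h y hy, sub_self]
  have hEq : EqOn (fun y => W t y - a₀) 0 univ :=
    han.eqOn_zero_of_preconnected_of_eventuallyEq_zero isPreconnected_univ (mem_univ z) hz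
  intro y
  have h1 := hEq (mem_univ y)
  simp only [Pi.zero_apply, sub_eq_zero] at h1
  exact h1

/-- **(K2) A slice with zero gradient on a ball kills** the whole field. -/
theorem eq_zero_of_fderiv_slice_ball {M : ℝ} {W : ℝ → E3 → E3} (hW : IsTypeIAncientMild M W)
    {z : E3} {r : ℝ} (hr : 0 < r) (h : ∀ y ∈ closedBall z r, fderiv ℝ (W (-1)) y = 0) :
    ∀ t < 0, ∀ y : E3, W t y = 0 := by
  have hdiff : Differentiable ℝ (W (-1)) := (hW.contDiff_slice (by norm_num)).differentiable (by simp)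
  have hconst : ∀ y ∈ ball z r, W (-1) y = W (-1) z := by
    intro y hy
    have hb := (convex_closedBall z r).norm_image_sub_le_of_norm_fderiv_le (𝕜 := ℝ) (f := W (-1)) (C := 0)
      (fun x _ => hdiff x) (fun x hx => by rw [h x hx, norm_zero]) (mem_closedBall_self hr.le)
      (mem_closedBall.2 (mem_ball.1 hy).le)
    rw [zero_mul] at hb
    exact sub_eq_zero.1 (norm_le_zero_iff.1 hb)
  exact eq_zero_of_sliceConst hW (slice_const_of_ball hW (by norm_num) hr hconst)

/-- **Rigid pockets at ONE instant `t`**: every `Λ`-fast point has, within `A√(ν(T−t))`, the centre of a closed ball of radius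
`a√(ν(T−t))` on which the DIMENSIONLESS GRADIENT `(T − t)|∇u(t, ·)|` is `≤ ε`. -/
def RigidPocketsAt (ν T : ℝ) (u : ℝ → E3 → E3) (Λ A a ε t : ℝ) : Prop :=
  ∀ x ∈ TwoTimeTop.topSet ν T u Λ t, ∃ z : E3, ‖z - x‖ ≤ A * Real.sqrt (ν * (T - t)) ∧
    ∀ x' : E3, ‖x' - z‖ ≤ a * Real.sqrt (ν * (T - t)) → (T - t) * ‖fderiv ℝ (u t) x'‖ ≤ ε

/-- **ROW F1rs «RIGID-POCKET SNAPSHOTS»** (Type I · no symmetry · Clay class; PROVED, `rowF1rs_holds`): as `Row_F1cs` with rigid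
pockets in place of calm ones. -/
def Row_F1rs : Prop :=
  ∀ (M A a : ℝ), 0 < a → ∃ ε : ℝ, 0 < ε ∧
    ∀ (ν T : ℝ), 0 < ν → 0 < T → ∀ (u : ℝ → E3 → E3) (p : ℝ → E3 → ℝ),
    IsClassicalNSSolutionOn (Ico 0 T) ν 0 u p → IsLerayHopfOn T ν 0 (u 0) u →
    HasRapidSpatialDecay (u 0) → OneLevelTop.HasTypeIConstant ν T M u →
    (∃ᶠ t in 𝓝[<] T, RigidPocketsAt ν T u snapLevel A a ε t) →
    HasSmoothExtensionPast ν 0 u T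

/-- The **rigid defect below `Λ`** on the slice `s = −1`. -/
def RigidDefectBelow (A a Λ : ℝ) (W : ℝ → E3 → E3) : Prop :=
  ∃ z ∈ closedBall (0 : E3) A, ∀ y ∈ closedBall z (a / 2), ‖fderiv ℝ (W (-1)) y‖ ≤ Λ

/-- **THE RIGID-POCKET LEVEL** (socket + (K2)). -/
theorem exists_rigidLevel (M A a : ℝ) (ha : 0 < a) {κ : ℝ} (hκ : 0 < κ) :
    ∃ Λ₁ : ℝ, 0 < Λ₁ ∧ ∀ W : ℝ → E3 → E3, IsTypeIAncientMild M W → κ ≤ ‖W (-1) 0‖ →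
      ¬ RigidDefectBelow A a Λ₁ W := by
  refine exists_level_of_limitKill M hκ (RigidDefectBelow A a) ?_
  intro Wn W ε hεpos hεlim hWn hW hP _ hgrad
  choose z hz hrig using hP
  have ha2 : 0 < a / 2 := by positivity
  obtain ⟨ζ₀, -, hζ₀⟩ := pocket_limit ha2 hz hεlim (fun y => hgrad (-1) (by norm_num) y) hrig
  have hball : ∀ y ∈ closedBall ζ₀ (a / 2 / 2), fderiv ℝ (W (-1)) y = 0 := fun y hy =>
    norm_le_zero_iff.1 (hζ₀ y hy)
  exact eq_zero_of_fderiv_slice_ball hW (by positivity) hball (-1) (by norm_num) 0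

/-- **The zoom gradient**: `∇_y [c u(τ, x₀ + cν y)] = c · cν · (∇u)(τ, x₀ + cν y)` at a classical time `τ = T − c²ν ∈ [0, T)`. -/
theorem fderiv_zoom_slice {ν T c : ℝ} {u : ℝ → E3 → E3} {p : ℝ → E3 → ℝ}
    (hsol : IsClassicalNSSolutionOn (Ico 0 T) ν 0 u p) (hτ : T + c ^ 2 * ν * (-1) ∈ Ico 0 T) (x₀ y : E3) :
    fderiv ℝ (fun y' : E3 => (c * 1) • u (T + c ^ 2 * ν * (-1)) (x₀ + (c * ν) • y')) y =
      ((c * 1) * (c * ν)) • fderiv ℝ (u (T + c ^ 2 * ν * (-1))) (x₀ + (c * ν) • y) := by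
  have hU : Differentiable ℝ (u (T + c ^ 2 * ν * (-1))) := (hsol.contDiff_velocity hτ).differentiable (by simp)
  have hd : Differentiable ℝ (stPull (c ^ 2 * ν) (c * ν) T x₀ u (-1)) := differentiable_stPull_slice hU
  have e : (fun y' : E3 => (c * 1) • u (T + c ^ 2 * ν * (-1)) (x₀ + (c * ν) • y')) =
      (c * 1) • stPull (c ^ 2 * ν) (c * ν) T x₀ u (-1) := rfl
  rw [e, fderiv_const_smul (hd y), fderiv_stPull, smul_smul]

/-- **ROW F1rs holds** (snapshot package + rigid level). -/
theorem rowF1rs_holds : Row_F1rs := by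
  intro M A a ha
  obtain ⟨Λ₁, hΛ₁, hlev⟩ := exists_rigidLevel M A a ha snapLevel_pos
  refine ⟨Λ₁, hΛ₁, ?_⟩
  intro ν T hν hT u p hsol hLH hdec hM hfreq
  by_contra hmax
  -- refine the frequent set of instants by `t ∈ [0, T)` (classical times, for the chain rule)
  have hfreq' : ∃ᶠ t in 𝓝[<] T, RigidPocketsAt ν T u snapLevel A a Λ₁ t ∧ t ∈ Ico (0 : ℝ) T :=
    hfreq.and_eventually (Ico_mem_nhdsLT hT)
  obtain ⟨c, x, W, hcpos, -, hW, hQ, hxfast, -, hgrad, hnorm⟩ :=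
    exists_snapshotZoom_package hν hT hsol hLH hdec hM hmax hfreq'
  apply hlev W hW hnorm
  have hunit : ∀ j, Real.sqrt (ν * (T - (T + c j ^ 2 * ν * (-1)))) = c j * ν := by
    intro j
    rw [show T - (T + c j ^ 2 * ν * (-1)) = c j ^ 2 * ν by ring]
    exact sqrt_mul_sq_mul hν (hcpos j)
  have hpk : ∀ j, ∃ ζ : E3, ζ ∈ closedBall (0 : E3) A ∧ ∀ y ∈ closedBall ζ a,
      ‖fderiv ℝ (fun y' : E3 => (c j * 1) • u (T + c j ^ 2 * ν * (-1)) (x j + (c j * ν) • y')) y‖ ≤ Λ₁ := by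
    intro j
    obtain ⟨z, hzx, hrig⟩ := (hQ j).1 (x j) (hxfast j)
    have hcν : 0 < c j * ν := mul_pos (hcpos j) hν
    refine ⟨(c j * ν)⁻¹ • (z - x j), ?_, fun y hy => ?_⟩
    · rw [mem_closedBall, dist_zero_right, norm_smul, norm_inv, Real.norm_eq_abs, abs_of_pos hcν,
        inv_mul_le_iff₀ hcν]
      rw [hunit j] at hzx
      linarith
    · have hx' : ‖x j + (c j * ν) • y - z‖ ≤ a * Real.sqrt (ν * (T - (T + c j ^ 2 * ν * (-1)))) := by
        rw [hunit j]
        have e : x j + (c j * ν) • y - z = (c j * ν) • (y - (c j * ν)⁻¹ • (z - x j)) := by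
          rw [smul_sub, smul_smul, mul_inv_cancel₀ hcν.ne', one_smul]
          abel
        rw [e, norm_smul, Real.norm_eq_abs, abs_of_pos hcν]
        rw [mem_closedBall, dist_eq_norm] at hy
        nlinarith
      have h1 := hrig _ hx'
      rw [show T - (T + c j ^ 2 * ν * (-1)) = c j ^ 2 * ν by ring] at h1
      rw [fderiv_zoom_slice hsol (hQ j).2 (x j) y, norm_smul, Real.norm_eq_abs,
        abs_of_pos (mul_pos (mul_pos (hcpos j) one_pos) hcν)]
      calc c j * 1 * (c j * ν) * ‖fderiv ℝ (u (T + c j ^ 2 * ν * (-1))) (x j + (c j * ν) • y)‖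
          = c j ^ 2 * ν * ‖fderiv ℝ (u (T + c j ^ 2 * ν * (-1))) (x j + (c j * ν) • y)‖ := by ring
        _ ≤ Λ₁ := h1
  choose ζ hζ hrigζ using hpk
  obtain ⟨ζ₀, hζ₀, hlim⟩ := pocket_limit ha hζ (tendsto_const_nhds (x := Λ₁))
    (fun y => hgrad (-1) (by norm_num) y) hrigζ
  exact ⟨ζ₀, hζ₀, hlim⟩

/-- **The rigid threshold `ε₁(M, A, a)`** and **the every-time RIGID FLOOR**: at a maximal Type-I Clay blow-up, at EVERY late
instant some `c_S`-fast point has no rigid pocket — every closed ball of radius `a√(ν(T−t))` within `A√(ν(T−t))` of it contains a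
point where `(T − t)|∇u| > ε₁(M, A, a)`.  PROVED. -/
def rigidLevel (M A a : ℝ) : ℝ := if ha : 0 < a then Classical.choose (rowF1rs_holds M A a ha) else 1

/-- The rigid level is positive. -/
theorem rigidLevel_pos (M A a : ℝ) : 0 < rigidLevel M A a := by
  unfold rigidLevel
  split_ifs with ha
  · exact (Classical.choose_spec (rowF1rs_holds M A a ha)).1
  · exact one_pos

/-- The defining property of the rigid level. -/
theorem rigidLevel_spec {a : ℝ} (M A : ℝ) (ha : 0 < a) :
    ∀ (ν T : ℝ), 0 < ν → 0 < T → ∀ (u : ℝ → E3 → E3) (p : ℝ → E3 → ℝ),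
    IsClassicalNSSolutionOn (Ico 0 T) ν 0 u p → IsLerayHopfOn T ν 0 (u 0) u →
    HasRapidSpatialDecay (u 0) → OneLevelTop.HasTypeIConstant ν T M u →
    (∃ᶠ t in 𝓝[<] T, RigidPocketsAt ν T u snapLevel A a (rigidLevel M A a) t) →
    HasSmoothExtensionPast ν 0 u T := by
  have e : rigidLevel M A a = Classical.choose (rowF1rs_holds M A a ha) := by
    unfold rigidLevel; rw [dif_pos ha]
  rw [e]
  exact (Classical.choose_spec (rowF1rs_holds M A a ha)).2

/-- **RIGID FLOOR** (structural, maximal frame): recurrent non-rigid pockets at the definite rigid level. -/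
def RigidFloor : Prop :=
  ∀ (ν T : ℝ), 0 < ν → 0 < T → ∀ (u : ℝ → E3 → E3) (p : ℝ → E3 → ℝ),
    IsMaximalSmoothSolution ν 0 u p T → IsLerayHopfOn T ν 0 (u 0) u → HasRapidSpatialDecay (u 0) →
    ∀ M A a : ℝ, OneLevelTop.HasTypeIConstant ν T M u → 0 < a →
      ∀ᶠ t in 𝓝[<] T, ¬ RigidPocketsAt ν T u snapLevel A a (rigidLevel M A a) t

/-- **The RIGID FLOOR holds.** -/
theorem rigidFloor_holds : RigidFloor := by
  intro ν T hν hT u p hmax hLH hdec M A a hM ha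
  by_contra hno
  rw [Filter.not_eventually] at hno
  apply hmax.2 (rigidLevel_spec M A ha ν T hν hT u p hmax.1 hLH hdec hM ?_)
  exact hno.mono fun t ht => not_not.1 ht

/-! ## §7 Order remarks (in kernel where cheap) and summary -/

/-- Calm pockets are MONOTONE in the threshold: `ε`-calm pockets are `ε'`-calm for `ε ≤ ε'` (so the row at `ε(M, A, a)` covers
every smaller threshold). -/
theorem calmPocketsAt_mono {ν T : ℝ} {u : ℝ → E3 → E3} {Λ A a ε ε' t : ℝ} (hle : ε ≤ ε')
    (h : CalmPocketsAt ν T u Λ A a ε t) : CalmPocketsAt ν T u Λ A a ε' t := by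
  intro x hx
  obtain ⟨z, hz, hcalm⟩ := h x hx
  exact ⟨z, hz, fun x' hx' => (hcalm x' hx').trans (mul_le_mul_of_nonneg_right hle (Real.sqrt_nonneg ν))⟩

/-- Calm pockets are MONOTONE in the level: a condition on the `Λ`-fast points implies the same condition on the `Λ'`-fast points
for `Λ ≤ Λ'` (fewer points to serve). -/
theorem calmPocketsAt_mono_level {ν T : ℝ} {u : ℝ → E3 → E3} {Λ Λ' A a ε t : ℝ} (hle : Λ ≤ Λ')
    (h : CalmPocketsAt ν T u Λ A a ε t) : CalmPocketsAt ν T u Λ' A a ε t :=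
  fun x hx => h x (TwoTimeTop.mem_topSet_of_le (Real.sqrt_nonneg ν) hle hx)

/-- The `∀ᶠ` form implies the `∃ᶠ` form of any snapshot hypothesis (the filter `𝓝[<] T` is non-trivial): the quantifier gain of
this line is one-directional. -/
theorem frequently_of_eventually_nhdsLT {T : ℝ} {Q : ℝ → Prop} (h : ∀ᶠ t in 𝓝[<] T, Q t) : ∃ᶠ t in 𝓝[<] T, Q t :=
  h.frequently

/-- **Summary of LINE 36.** -/
theorem snapshotTop_summary :
    Row_F1cs ∧ Row_F1rs ∧ SnapshotFloor ∧ RigidFloor ∧ (SnapshotCollapse ↔ ScenarioCensus.Row_F1) ∧ Row_F1po :=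
  ⟨rowF1cs_holds, rowF1rs_holds, snapshotFloor_holds, rigidFloor_holds, snapshotCollapse_iff_rowF1, rowF1po_of_rowF1cs rowF1cs_holds⟩

end Summit.NavierStokesRegularity.NavierStokesRegularity.Theorems.ScenarioCensus.SnapshotTop

namespace Summit.NavierStokesRegularity.NavierStokesRegularity.Theorems.ScenarioCensus

/-! ## Census KEYS (ns `…Theorems.ScenarioCensus`): the SNAPSHOT members of row F1 — TREE-decided F1cs / F1ce / F1rs and floors SF / RF -/

/-- **Cell F1cs** (CALM SNAPSHOT: Type I with constant `M` · at ONE late instant, calm pockets of definite size at the level `calmLevel M A a` ⇒ smooth extension past `T`): `:= SnapshotTop.Row_F1cs`. DECIDED. -/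
def Row_F1cs : Prop := SnapshotTop.Row_F1cs
/-- F1cs is EXCLUDED (decided in the tree): `SnapshotTop.rowF1cs_holds`. -/
theorem row_F1cs_excluded : Row_F1cs := SnapshotTop.rowF1cs_holds

/-- **Cell F1ce** (`ε`-form of the calm snapshot): `:= SnapshotTop.Row_F1ce`. DECIDED. -/
def Row_F1ce : Prop := SnapshotTop.Row_F1ce
/-- F1ce is EXCLUDED (decided in the tree): `SnapshotTop.rowF1ce_holds`. -/
theorem row_F1ce_excluded : Row_F1ce := SnapshotTop.rowF1ce_holds

/-- **Cell F1rs** (RIGID pockets — plug flow at the critical scale — at one instant): `:= SnapshotTop.Row_F1rs`. DECIDED. -/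
def Row_F1rs : Prop := SnapshotTop.Row_F1rs
/-- F1rs is EXCLUDED (decided in the tree): `SnapshotTop.rowF1rs_holds`. -/
theorem row_F1rs_excluded : Row_F1rs := SnapshotTop.rowF1rs_holds

/-- **Floor SF — the EVERY-TIME (snapshot) floor**: `SnapshotTop.snapshotFloor_holds`. -/
theorem row_F1_snapshotFloor : SnapshotTop.SnapshotFloor := SnapshotTop.snapshotFloor_holds
/-- **Floor RF — RIGID FLOOR**: `SnapshotTop.rigidFloor_holds`. -/
theorem row_F1_rigidFloor : SnapshotTop.RigidFloor := SnapshotTop.rigidFloor_holds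
/-- Order edges at key level: F1cs ⇒ F1ce, F1cs ⇒ F1po (`SnapshotTop.rowF1ce_of_rowF1cs` / `rowF1po_of_rowF1cs`). -/
theorem rowF1ce_of_rowF1cs : Row_F1cs → Row_F1ce := SnapshotTop.rowF1ce_of_rowF1cs
/-- See `rowF1ce_of_rowF1cs`. -/
theorem rowF1po_of_rowF1cs : Row_F1cs → Row_F1po := SnapshotTop.rowF1po_of_rowF1cs

end Summit.NavierStokesRegularity.NavierStokesRegularity.Theorems.ScenarioCensus

end
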